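import Literature.AnabelianGeometry.SemiGraphs.CoveringOfObjectProofs
import Literature.AnabelianGeometry.SemiGraphs.CoveringHomCanonical
import Literature.AnabelianGeometry.SemiGraphs.FiniteEtaleCoveringGlobalDef
import Literature.AnabelianGeometry.Anabelioids.TerminalCoproductComponents
import Literature.AnabelianGeometry.Anabelioids.TrivialObjectFibre

/-!
# Point alignment for the covering `𝒢_A → 𝒢` attached to an object of `B(𝒢)` ([SemiAnbd] §2 p. 23)

Mochizuki, *Semi-graphs of anabelioids*, Publ. RIMS **42** (2006) 221–322, §2 p. 23 (the finite
étale covering `𝒢′ → 𝒢` ATTACHED TO an object `A ∈ B(𝒢)`: constituents the component anabelioids,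
`b′_*` the slices of `b_*`) [cite: MochizukiSemiAnbd2006, Def. 2.2(i) p.23].  abc-iut cell, layer L3,
DISCHARGE-L3 §G row G25-G9 (abc-iut-L4-t17; finding L4t17-F1 / ruling μ2), part 1 of 2: the
POINT ALIGNMENT for abc-iut-L3-t5's construction `coveringHomCan A : 𝒢_A → 𝒢` (canonical 2-cells
`twoIsoCan`): at a branch `(b, Q)` abutting to `(v, P)`, the canonical edge base point
`t₀ ∈ F_e′(Q × Q)`, pushed along the inclusion `ι_Q : Q ↪ b^* P` and the aligned frame, is the
canonical vertex base point `s₀ ∈ F′(P × P)` (`alignIso_point`).  The heart is a diagram identity in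
`Over Q` — the section `Q → Q × b^*P`, `q ↦ (q, ι_Q q)` (graph of `ι_Q`), followed by the inverse of
the canonical comparison `gluingStarIsoCan_P : b^*(P × P) ×_{b^*P} Q ≅ Q × b^*P`, IS the image under
the gluing functor of the diagonal `P → P × P` (`diag_graph_eq_gluing_diag`, checked on the two
pull-back projections with abc-iut-L3-t5's closed forms `gluingStarIsoCan_hom_app_left_fst /
…_comp_gluingStarMap`) — transported through the `Shrink` models, the unit of the model equivalence
and the fibre functors.  Part 2 (`CoveringHomCanBranchAligned`) concludes `Hom.IsBranchAligned`.
Nothing here takes a side on [IUTchIII] Cor. 3.12; typed ≠ discharged.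
-/

namespace Literature.AnabelianGeometry.SemiGraphs

open CategoryTheory CategoryTheory.Limits CategoryTheory.PreGaloisCategory
open Literature.AnabelianGeometry.Anabelioids

universe v₁ u₁ u

-- Mathlib's `Over.pullback` / `Over.star` simp lemmas only fire under the pre-v4.2x defeq
-- transparency behaviour (as in `CoveringHomCanonical.lean`).
set_option backward.isDefEq.respectTransparency false

namespace SemiGraphOfAnabelioids

namespace BObj

variable {𝒢 : SemiGraphOfAnabelioids.{v₁, u₁, u}} (A : 𝒢.BObj)

/-! ### The diagram identity in `Over Q` -/

/-- The canonical section `(Q = Q) ⟶ (b^* P ×_{b^* P} Q → Q)` of the (terminal) image of `P = P`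
under the gluing functor: `q ↦ (ι_Q q, q)`. [cite: MochizukiSemiAnbd2006, Def. 2.2(i) p.23] -/
noncomputable def gluingUnitSection {b : 𝒢.graph.Branch} {v : 𝒢.graph.Vertex}
    (h : 𝒢.graph.abuts b = some v) (P : Subobject (A.S v)) (Q : Subobject (A.T (𝒢.graph.edgeOf b)))
    (hle : Q ≤ A.branchImage b v h P) :
    Over.mk (𝟙 (Q : 𝒢.E (𝒢.graph.edgeOf b))) ⟶
      (A.gluingFunctor h P Q hle).obj (Over.mk (𝟙 (P : 𝒢.V v))) :=
  Over.homMk (pullback.lift (A.inclOfLE h P Q hle) (𝟙 _) (by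
      show A.inclOfLE h P Q hle ≫ (𝒢.pull b v h).pullback.map (𝟙 _) = 𝟙 _ ≫ A.inclOfLE h P Q hle
      simp))
    (by
      show pullback.lift _ _ _ ≫ pullback.snd _ _ = 𝟙 _
      exact pullback.lift_snd _ _ _)

/-- The section `gluingUnitSection` has first projection `ι_Q`. [cite: MochizukiSemiAnbd2006, Def. 2.2(i) p.23] -/
@[reassoc] theorem gluingUnitSection_left_fst {b : 𝒢.graph.Branch} {v : 𝒢.graph.Vertex}
    (h : 𝒢.graph.abuts b = some v) (P : Subobject (A.S v)) (Q : Subobject (A.T (𝒢.graph.edgeOf b)))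
    (hle : Q ≤ A.branchImage b v h P) :
    (A.gluingUnitSection h P Q hle).left ≫ pullback.fst _ _ = A.inclOfLE h P Q hle :=
  pullback.lift_fst _ _ _

/-- The section `gluingUnitSection` has second projection the identity. [cite: MochizukiSemiAnbd2006, Def. 2.2(i) p.23] -/
@[reassoc] theorem gluingUnitSection_left_snd {b : 𝒢.graph.Branch} {v : 𝒢.graph.Vertex}
    (h : 𝒢.graph.abuts b = some v) (P : Subobject (A.S v)) (Q : Subobject (A.T (𝒢.graph.edgeOf b)))
    (hle : Q ≤ A.branchImage b v h P) :
    (A.gluingUnitSection h P Q hle).left ≫ pullback.snd _ _ = 𝟙 _ :=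
  pullback.lift_snd _ _ _

/-- The DIAGONAL section `(X = X) ⟶ (X × X →pr₁ X)` of `Over X`, `x ↦ (x, x)` — equal to the unit
of `forget ⊣ star` at `X = X` (`diagSection_eq_unit`), but with its underlying map `prod.lift 1 1`
definitionally. [cite: MochizukiSemiAnbd2006, Def. 2.2(i) p.23] -/
noncomputable def diagSection {C : Type u₁} [Category.{v₁} C] [HasBinaryProducts C] (X : C) :
    Over.mk (𝟙 X) ⟶ (Over.star X).obj X :=
  Over.homMk (prod.lift (𝟙 X) (𝟙 X)) (by simp)

/-- The underlying map of the diagonal section. [cite: MochizukiSemiAnbd2006, Def. 2.2(i) p.23] -/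
@[simp] theorem diagSection_left {C : Type u₁} [Category.{v₁} C] [HasBinaryProducts C] (X : C) :
    (diagSection X).left = prod.lift (𝟙 X) (𝟙 X) := rfl

/-- The diagonal section is the unit of `Over.forget X ⊣ Over.star X` at `X = X`.
[cite: MochizukiSemiAnbd2006, Def. 2.2(i) p.23] -/
theorem diagSection_eq_unit {C : Type u₁} [Category.{v₁} C] [HasBinaryProducts C] (X : C) :
    diagSection X = (Over.forgetAdjStar X).unit.app (Over.mk (𝟙 X)) := by
  ext
  erw [Over.forgetAdjStar_unit_app_left]
  rfl

/-- **The graph of `ι_Q` is the gluing of the diagonal.** In `Over Q`: the section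
`Q ⟶ Q × Q ⟶ Q × b^* P` (diagonal then `Q × ι_Q`) followed by the inverse of the canonical comparison
`(gluingStarIsoCan_P)⁻¹ : Q × b^* P ⟶ b^*(P × P) ×_{b^* P} Q` equals the canonical section of
`b^* P ×_{b^*P} Q` followed by the gluing functor applied to the diagonal `P ⟶ P × P` — both have
projections `(ι_Q ≫ b^*Δ, 1)`. [cite: MochizukiSemiAnbd2006, Def. 2.2(i) p.23] -/
@[reassoc] theorem diag_graph_eq_gluing_diag {b : 𝒢.graph.Branch} {v : 𝒢.graph.Vertex}
    (h : 𝒢.graph.abuts b = some v) (P : Subobject (A.S v)) (Q : Subobject (A.T (𝒢.graph.edgeOf b)))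
    (hle : Q ≤ A.branchImage b v h P) :
    diagSection (Q : 𝒢.E (𝒢.graph.edgeOf b)) ≫
        (Over.star (Q : 𝒢.E (𝒢.graph.edgeOf b))).map (A.inclOfLE h P Q hle) ≫
          (A.gluingStarIsoCan h P Q hle).inv.app (P : 𝒢.V v) =
      A.gluingUnitSection h P Q hle ≫ (A.gluingFunctor h P Q hle).map (diagSection (P : 𝒢.V v)) := by
  haveI : PreservesFiniteLimits (𝒢.pull b v h).pullback := (𝒢.pull b v h).property.1
  -- the two projections of the inverse comparison
  have hinv_fst : ((A.gluingStarIsoCan h P Q hle).inv.app (P : 𝒢.V v)).left ≫ pullback.fst _ _ =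
      A.gluingStarMap h P Q hle (P : 𝒢.V v) := by
    rw [← A.gluingStarIsoCan_hom_app_left_comp_gluingStarMap h P Q hle, ← Category.assoc,
      ← Over.comp_left, Iso.inv_hom_id_app, Over.id_left, Category.id_comp]
  have hinv_snd : ((A.gluingStarIsoCan h P Q hle).inv.app (P : 𝒢.V v)).left ≫ pullback.snd _ _ =
      Limits.prod.fst := by
    rw [← A.gluingStarIsoCan_hom_app_left_fst h P Q hle, ← Category.assoc,
      ← Over.comp_left, Iso.inv_hom_id_app, Over.id_left, Category.id_comp]
  -- the key computation `Δ ≫ (1 × ι) ≫ gluingStarMap = ι ≫ b^*Δ`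
  have hkey : prod.lift (𝟙 (Q : 𝒢.E (𝒢.graph.edgeOf b))) (𝟙 _) ≫
      prod.map (𝟙 _) (A.inclOfLE h P Q hle) ≫ A.gluingStarMap h P Q hle (P : 𝒢.V v) =
        A.inclOfLE h P Q hle ≫ (𝒢.pull b v h).pullback.map (prod.lift (𝟙 _) (𝟙 _)) := by
    rw [gluingStarMap, ← Category.assoc, ← Category.assoc]
    refine (IsIso.comp_inv_eq _).mpr ?_
    apply Limits.prod.hom_ext
    · simp only [Category.assoc, prod.map_fst, prod.map_fst_assoc, prod.lift_fst_assoc,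
        Category.id_comp, prodComparison_fst]
      rw [← (𝒢.pull b v h).pullback.map_comp, prod.lift_fst, (𝒢.pull b v h).pullback.map_id,
        Category.comp_id]
    · simp only [Category.assoc, prod.map_snd, prod.lift_snd_assoc,
        Category.id_comp, Category.comp_id, prodComparison_snd]
      rw [← (𝒢.pull b v h).pullback.map_comp, prod.lift_snd, (𝒢.pull b v h).pullback.map_id,
        Category.comp_id]
  have hsm : ((Over.star (Q : 𝒢.E (𝒢.graph.edgeOf b))).map (A.inclOfLE h P Q hle)).left =
      prod.map (𝟙 _) (A.inclOfLE h P Q hle) := Over.star_map_left _ _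
  ext
  rw [Over.comp_left, Over.comp_left, Over.comp_left, diagSection_left]
  simp only [hsm]
  apply pullback.hom_ext
  · simp only [Category.assoc]
    rw [hinv_fst, hkey, gluingFunctor_map_left_fst, gluingUnitSection_left_fst_assoc, diagSection_left]
  · simp only [Category.assoc]
    rw [hinv_snd, prod.map_fst, prod.lift_fst_assoc, gluingFunctor_map_left_snd,
      gluingUnitSection_left_snd]
    exact Category.comp_id _

/-! ### Point alignment for `coveringHomCan` -/

/-- **Point alignment for the covering attached to `A`.** At a branch `(b, Q)` of `𝒢_A` abutting to
`(v, P)`, for basepoints `F′` of `(𝒢_v)_P`, `F_e′` of `(𝒢_e)_Q` and a frame `α′`, the canonical edge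
base point `t₀ = F_e′(Δ_Q)(t′) ∈ F_e′(Q × Q)`, pushed along `ι_Q : Q ↪ b^* P` and the aligned frame of
`coveringHomCan`, is the canonical vertex base point `s₀ = F′(Δ_P)(t) ∈ F′(P × P)` — by
`diag_graph_eq_gluing_diag`, naturality of the unit of the `Shrink` model and of `α′`, and the
one-point fibre of `P = P`. [cite: MochizukiSemiAnbd2006, Def. 2.2(i) p.23] -/
theorem alignIso_point (bc : A.fibreData.total.Branch) (vc : A.fibreData.total.Vertex)
    (h' : A.fibreData.total.abuts bc = some vc)
    (F' : A.coveringGraph.V vc ⥤ FintypeCat.{v₁}) [FiberFunctor F']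
    (Fe' : A.coveringGraph.E (A.fibreData.total.edgeOf bc) ⥤ FintypeCat.{v₁}) [FiberFunctor Fe']
    (α' : (A.coveringGraph.pull bc vc h').pullback ⋙ Fe' ≅ F')
    (t : F'.obj ((Shrink.equivalence (Over ((A.vComp vc).1 : 𝒢.V (A.fibreData.proj.vertexMap vc)))).functor.obj
      (Over.mk (𝟙 _))))
    (t' : Fe'.obj ((Shrink.equivalence (Over ((A.brComp bc).1 :
      𝒢.E (𝒢.graph.edgeOf (A.fibreData.proj.branchMap bc))))).functor.obj (Over.mk (𝟙 _)))) :
    (A.coveringHomCan.alignIso bc vc h' (A.fibreData.proj.branchMap bc) rfl F' Fe' α').hom.app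
        ((A.vComp vc).1 : 𝒢.V (A.fibreData.proj.vertexMap vc))
        (((A.coveringHomCan.φE (A.fibreData.total.edgeOf bc)
            (𝒢.graph.edgeOf (A.fibreData.proj.branchMap bc))
            (A.fibreData.proj.edgeOf_branchMap bc).symm).pullback ⋙ Fe').map
          (A.inclOfLE (abuts_fst h') (A.vComp vc).1 (A.brComp bc).1 (brComp_le_branchImage h'))
          (Fe'.map ((Shrink.equivalence (Over ((A.brComp bc).1 :
              𝒢.E (𝒢.graph.edgeOf (A.fibreData.proj.branchMap bc))))).functor.map
            (diagSection _)) t')) =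
      F'.map ((Shrink.equivalence (Over ((A.vComp vc).1 : 𝒢.V (A.fibreData.proj.vertexMap vc)))).functor.map
        (diagSection _)) t := by
  -- notation
  let v := A.fibreData.proj.vertexMap vc
  let b := A.fibreData.proj.branchMap bc
  let hb : 𝒢.graph.abuts b = some v := abuts_fst h'
  let P : Subobject (A.S v) := (A.vComp vc).1
  let Qc : Subobject (A.T (𝒢.graph.edgeOf b)) := (A.brComp bc).1
  let hle : Qc ≤ A.branchImage b v hb P := brComp_le_branchImage h'
  let eP := Shrink.equivalence (Over (P : 𝒢.V v))
  let eQ := Shrink.equivalence (Over (Qc : 𝒢.E (𝒢.graph.edgeOf b)))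
  -- the 2-cell, unfolded
  have hγ : (A.twoIsoCan bc vc h').inv.app (P : 𝒢.V v) =
      eQ.functor.map ((A.gluingStarIsoCan hb P Qc hle).inv.app (P : 𝒢.V v) ≫
        (Over.pullback (A.inclOfLE hb P Qc hle)).map ((Over.post (𝒢.pull b v hb).pullback).map (eP.unitIso.hom.app ((Over.star (P : 𝒢.V v)).obj (P : 𝒢.V v))))) := by
    rw [eQ.functor.map_comp]
    rfl
  -- the point before applying `α′`, as the image of `t′` under ONE morphism of `Over Q`
  have h1 : Fe'.map (eQ.functor.map (diagSection _)) ≫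
      Fe'.map (eQ.functor.map ((Over.star (Qc : 𝒢.E (𝒢.graph.edgeOf b))).map (A.inclOfLE hb P Qc hle))) ≫
        Fe'.map ((A.twoIsoCan bc vc h').inv.app (P : 𝒢.V v)) =
      Fe'.map (eQ.functor.map (A.gluingUnitSection hb P Qc hle ≫
        (Over.pullback (A.inclOfLE hb P Qc hle)).map ((Over.post (𝒢.pull b v hb).pullback).map (eP.unitIso.hom.app (Over.mk (𝟙 (P : 𝒢.V v))))))) ≫
        ((A.coveringGraph.pull bc vc h').pullback ⋙ Fe').map (eP.functor.map (diagSection (P : 𝒢.V v))) := by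
    have hnat : diagSection (P : 𝒢.V v) ≫ eP.unitIso.hom.app ((Over.star (P : 𝒢.V v)).obj (P : 𝒢.V v)) =
        eP.unitIso.hom.app (Over.mk (𝟙 (P : 𝒢.V v))) ≫
          eP.inverse.map (eP.functor.map (diagSection (P : 𝒢.V v))) :=
      eP.unitIso.hom.naturality (diagSection (P : 𝒢.V v))
    rw [hγ, ← Fe'.map_comp, ← Fe'.map_comp, ← eQ.functor.map_comp, ← eQ.functor.map_comp,
      A.diag_graph_eq_gluing_diag_assoc hb P Qc hle,
      ← (Over.pullback (A.inclOfLE hb P Qc hle)).map_comp, ← (Over.post (𝒢.pull b v hb).pullback).map_comp,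
      hnat, (Over.post (𝒢.pull b v hb).pullback).map_comp, (Over.pullback (A.inclOfLE hb P Qc hle)).map_comp,
      ← Category.assoc (A.gluingUnitSection hb P Qc hle), eQ.functor.map_comp, Fe'.map_comp]
    rfl
  -- the fibre of `P = P` (model) is one point
  haveI : Subsingleton (F'.obj (eP.functor.obj (Over.mk (𝟙 (P : 𝒢.V v))))) := by
    have hT : IsTerminal (C := A.coveringGraph.V vc) (eP.functor.obj (Over.mk (𝟙 (P : 𝒢.V v)))) :=
      Over.mkIdTerminal.isTerminalObj (eP.functor : Over (P : 𝒢.V v) ⥤ A.coveringGraph.V vc) _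
    haveI := subsingleton_fiber_terminal F'
    exact (FintypeCat.equivEquivIso.symm (F'.mapIso
      (hT.uniqueUpToIso (terminalIsTerminal (C := A.coveringGraph.V vc))))).subsingleton
  -- assemble: rewrite the morphism, then `α′`-naturality and the one-point fibre
  show α'.hom.app _ ((Fe'.map (eQ.functor.map (diagSection _)) ≫
      Fe'.map (eQ.functor.map ((Over.star (Qc : 𝒢.E (𝒢.graph.edgeOf b))).map (A.inclOfLE hb P Qc hle))) ≫
        Fe'.map ((A.twoIsoCan bc vc h').inv.app (P : 𝒢.V v))) t') = _
  rw [h1, FintypeCat.comp_apply]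
  erw [FunctorToFintypeCat.naturality]
  exact congrArg (F'.map (eP.functor.map (diagSection (P : 𝒢.V v)))) (Subsingleton.elim _ _)

end BObj

end SemiGraphOfAnabelioids

end Literature.AnabelianGeometry.SemiGraphs
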